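import Summits.QuantumFields.YangMills.Theorems.LuscherReductionTwistedTraceScalingBOStiffFlatPushforward
import Summits.QuantumFields.YangMills.Theorems.LuscherReductionTwistedTraceScalingBOStiffCentralDensity
import Summits.QuantumFields.YangMills.Theorems.LuscherReductionTwistedTraceScalingBOStiffActionHessian
import Summits.QuantumFields.YangMills.Theorems.LuscherReductionTwistedTraceScalingBOStiffGaugeTail
import Summits.QuantumFields.YangMills.Theorems.LuscherReductionTwistedTraceScalingBOStiffCoreData
import Summits.QuantumFields.YangMills.Theorems.LuscherReductionTwistedTraceScalingBOStiffCentralLower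
import Summits.QuantumFields.YangMills.Theorems.LuscherReductionTwistedTraceScalingBOCentralSchedule
import Summits.QuantumFields.YangMills.Theorems.LuscherReductionTwistedTraceScalingBOStiffGapInputs
import Summits.QuantumFields.YangMills.Theorems.LuscherReductionTwistedTraceScalingBOStiffQuasimodeAtom
import Summits.QuantumFields.YangMills.Theorems.LuscherReductionTwistedTraceScalingBOStiffHST
import HarnessLib

/-!
# (B-ST) the bridge, concrete half II: ★★★ `hflat_record` — the flat Poincaré hypothesis of ✓`spec_gap_inputs_of_hflat` for the TRANSVERSE measure `π` on `cS β` with the door data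
# `(cD, cJ0)`, β-free `P₀ = 8/(1−ρ_L)`, any rate `δ > 0`; and ★★★ THE PEN CLOSED: `recordAnalyticInput` (lane A of S-BASE, crux `TwistedTraceScaling` stmt-QuantumFields-20203,
# C4-CORE, the (B-ST) pen, lead g22; `pub/ym-fleet/ym-luscher-20007-p1/HANDOFF-g22.md`)

* §1 the schedule: `r(β)²β → ∞` and the three exit-mass terms of ✓`flat_model_selfNormalised` on the schedule `R = r√(49β/π)`, `u = (1−ρ)r/2`, `t = (1−ρ)r/(2√Σγ²)`, `s = β⁻¹`
  tend to `0` (`tendsto_epsR`, `tendsto_epsCore`, `tendsto_gaugeTail`); `core_fit` — the core-stability inequality `(ρr + t√Σγ²)² + u² ≤ r²` and `r ≤ γ_k R`;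
* §2 ★★★ `hflat_record` — `∃ M₁ ∀ M ≥ M₁ ∃ P₀ > 0 ∀ δ > 0 ∀ᶠ β ∀ g` (bounded measurable, `= 0` off `cS β`):
  `∫_{cS} g²cD dπ − (∫_{cS} g cD dπ)²/∫_{cS} cD dπ ≤ P₀·½∫∫ (g x − g y)²·cJ0 dπ dπ + δ·∫_{cS} g²cD dπ`.
  Chain at fixed `β`: ✓`hflat_pushforward` (ν_β = vol∘flatMap⁻¹) → ✓`balLebesgue_eq_smul_map` + ✓`orthoTransverse_restrict_cS_sharp` (`(7/8)ρ₀κ·ν ≤ π ≤ (9/8)ρ₀κ·ν` on `cS`;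
  `κ_β`, `ρ₀` CANCEL) → ✓`ratio_le_of_two_sided` (`Z_ν/I_ν ≤ (C²/c)·Z_π/cIk`, `cIk > 0`) + ✓`central_density_compare` (`Z_π ≤ (9/8)·cZ`) → ✓`poincare_transport_of_kernel_le` (`J₂ = cJ0`);
  constants `ε = ε₂ = 1/8`, `η = 1/16`: `(9/7)³·(9/8)·e^{1/4}·2/(1−ρ_L) ≤ 8/(1−ρ_L) = P₀`.
* §3 ★★★ `recordAnalyticInput` — THE (B-ST) PEN: for `L ≥ 2` with a non-zero site and `1/6 < s < 1/4`, `∃ M₀ ≥ 2, ∀ M ≥ M₀, Nonempty (RecordAnalyticInput L s M)` — composition of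
  ✓`…BOStiffHST.recordAnalyticInput_of_specs` (hand w1) with (A) ✓`…BOStiffQuasimodeAtom.spec_S3` (hand w1, unconditional) and (B) ✓`…BOStiffGapInputs.spec_gap_inputs_of_hflat` (lead)
  fed with `hflat_record`; NO hypothesis beyond `Nonempty (NzSite L)`, `2 ≤ L`, `1/6 < s < 1/4`.
HONEST FRAMING: this closes the (B-ST) brick = the analytic input RECORD of C4-CORE at the central fibre for a stub of a child of the CONDITIONAL route R2b1 (Lüscher two-lattice
reduction), at fixed lattice size `L` with visibly `L`-dependent constants, eventually in `β`.  It is NOT the crux `TwistedTraceScaling` itself, not infinite volume, not a mass gap,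
not Clay.  No named facts, no `sorry`.
-/

set_option autoImplicit false

noncomputable section

open MeasureTheory Filter Topology
open scoped BigOperators RealInnerProductSpace ENNReal NNReal
open Literature.MathematicalPhysics.QuantumFieldTheory Literature.MathematicalPhysics.QuantumLattice

namespace Summit.QuantumFields.YangMills.Theorems.FemtoTransferGap.TwoLattice.ConstTube

open Summit.QuantumFields.YangMills.Theorems.FemtoTransferGap
open TwoLattice TwoLattice.Stiff TwoLattice.Cov TwoLattice.GnChart TwoLattice.Toron
open Literature.Analysis.SegalBargmann (vacCoef vacCoef_pos)

variable {L : ℕ} [NeZero L]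

/-! ## §1 The schedule -/

omit [NeZero L] in
/-- `r(β)²·β → ∞` on the schedule `r(β) = min(1/40, β^{-1/2}ℓ)` (indeed `= ℓ²` eventually). [folklore] -/
theorem tendsto_rad_sq_mul_atTop : Tendsto (fun β : ℝ => (min (1 / 40) (powScale (1 / 2) β * btLog β)) ^ 2 * β) atTop atTop := by
  have h1 : Tendsto (fun β : ℝ => powScale (1 / 2) β * btLog β) atTop (𝓝 0) := by
    simpa using tendsto_powScale_mul_btLog_pow (p := 1 / 2) (by norm_num) 1
  have hsmall : ∀ᶠ β : ℝ in atTop, powScale (1 / 2) β * btLog β ≤ 1 / 40 := h1.eventually (eventually_le_nhds (by norm_num : (0 : ℝ) < 1 / 40))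
  have hl : Tendsto (fun β : ℝ => btLog β ^ 2) atTop atTop := (tendsto_pow_atTop two_ne_zero).comp tendsto_btLog_atTop
  refine hl.congr' ?_
  filter_upwards [hsmall, eventually_ge_atTop (1 : ℝ)] with β hβs hβ
  have hβ0 : β ≠ 0 := by linarith
  rw [min_eq_right hβs, mul_pow, powScale_half_sq hβ]; field_simp

omit [NeZero L] in
/-- `A·exp(−c·r(β)²β) → 0` (`c > 0`). [folklore] -/
theorem tendsto_const_mul_exp_neg_rad (A : ℝ) {c : ℝ} (hc : 0 < c) :
    Tendsto (fun β : ℝ => A * Real.exp (-(c * ((min (1 / 40) (powScale (1 / 2) β * btLog β)) ^ 2 * β)))) atTop (𝓝 0) := by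
  have h := Real.tendsto_exp_neg_atTop_nhds_zero.comp (tendsto_rad_sq_mul_atTop.const_mul_atTop hc)
  simpa using h.const_mul A

/-- ★ The box exit mass `ε_R = 2n·exp(−π((1−ρ)R)²)`, `R = r√(49β/π)`, tends to `0` (`ρ < 1`). [folklore] -/
theorem tendsto_epsR {ρ : ℝ} (hρ1 : ρ < 1) :
    Tendsto (fun β : ℝ => 2 * (Fintype.card (StiffIdx L β) : ℝ) *
      Real.exp (-(Real.pi * ((1 - ρ) * (min (1 / 40) (powScale (1 / 2) β * btLog β) * Real.sqrt (49 * β / Real.pi))) ^ 2))) atTop (𝓝 0) := by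
  have h1ρ : 0 < 1 - ρ := sub_pos.2 hρ1
  have hc : 0 < 49 * (1 - ρ) ^ 2 := by positivity
  refine squeeze_zero' (Eventually.of_forall fun β => by positivity) ?_ (tendsto_const_mul_exp_neg_rad (2 * (Fintype.card (Edge 3 L × Fin 3) : ℝ)) hc)
  filter_upwards [eventually_ge_atTop (0 : ℝ)] with β hβ
  have hsq : Real.sqrt (49 * β / Real.pi) ^ 2 = 49 * β / Real.pi := Real.sq_sqrt (by positivity)
  have he : Real.pi * ((1 - ρ) * (min (1 / 40) (powScale (1 / 2) β * btLog β) * Real.sqrt (49 * β / Real.pi))) ^ 2 =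
      49 * (1 - ρ) ^ 2 * ((min (1 / 40) (powScale (1 / 2) β * btLog β)) ^ 2 * β) := by
    rw [mul_pow, mul_pow, hsq]; field_simp
  rw [he]
  have hcard : (Fintype.card (StiffIdx L β) : ℝ) ≤ Fintype.card (Edge 3 L × Fin 3) := by exact_mod_cast card_stiffIdx_le (L := L) β
  exact mul_le_mul_of_nonneg_right (mul_le_mul_of_nonneg_left hcard zero_le_two) (Real.exp_pos _).le

set_option maxHeartbeats 400000 in
/-- ★ The core exit mass `2n·exp(−πt²)`, `t = (1−ρ)r/(2√Σγ²)`, tends to `0` (`L ≥ 2`, `ρ < 1`). [folklore] -/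
theorem tendsto_epsCore (hL : 2 ≤ L) {ρ : ℝ} (hρ1 : ρ < 1) :
    Tendsto (fun β : ℝ => 2 * (Fintype.card (StiffIdx L β) : ℝ) *
      Real.exp (-(Real.pi * ((1 - ρ) * min (1 / 40) (powScale (1 / 2) β * btLog β) / (2 * Real.sqrt (∑ k : StiffIdx L β, flatScale L β k ^ 2))) ^ 2))) atTop (𝓝 0) := by
  set n₀ : ℝ := (Fintype.card (Edge 3 L × Fin 3) : ℝ) with hn₀
  set sg : ℝ := Real.sqrt (2 - 2 * Real.cos (2 * Real.pi / L)) with hsg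
  have hsg0 : 0 < sg := Real.sqrt_pos.2 (gap_pos L hL)
  have hn0 : (0 : ℝ) ≤ n₀ := by rw [hn₀]; positivity
  have hn1 : (0 : ℝ) < n₀ + 1 := by linarith
  have h1ρ : 0 < 1 - ρ := sub_pos.2 hρ1
  have hc : 0 < (1 - ρ) ^ 2 * sg / (4 * (n₀ + 1)) := by positivity
  refine squeeze_zero' (Eventually.of_forall fun β => by positivity) ?_ (tendsto_const_mul_exp_neg_rad (2 * n₀) hc)
  filter_upwards [eventually_gt_atTop (0 : ℝ)] with β hβ
  set r : ℝ := min (1 / 40) (powScale (1 / 2) β * btLog β) with hr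
  have hr0 : 0 ≤ r := le_min (by norm_num) (mul_nonneg (powScale_pos _ _).le (zero_le_one.trans (one_le_btLog β)))
  have hcard : (Fintype.card (StiffIdx L β) : ℝ) ≤ n₀ := by rw [hn₀]; exact_mod_cast card_stiffIdx_le (L := L) β
  by_cases h0 : Fintype.card (StiffIdx L β) = 0
  · rw [h0]; simp only [Nat.cast_zero, mul_zero, zero_mul]; exact mul_nonneg (mul_nonneg zero_le_two hn0) (Real.exp_pos _).le
  · -- `Σγ² > 0` and `πt² ≥ c·r²β`
    haveI : Nonempty (StiffIdx L β) := Fintype.card_pos_iff.1 (Nat.pos_of_ne_zero h0)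
    set S2 : ℝ := ∑ k : StiffIdx L β, flatScale L β k ^ 2 with hS2
    have hSpos : 0 < S2 := Finset.sum_pos (fun k _ => pow_pos (flatScale_pos_sq (L := L) hβ k).1 2) Finset.univ_nonempty
    have hSle : S2 ≤ n₀ * (Real.pi / (β * sg)) := sum_flatScale_sq_le (L := L) hL hβ
    have hSle' : S2 ≤ (n₀ + 1) * (Real.pi / (β * sg)) := hSle.trans (mul_le_mul_of_nonneg_right (by linarith) (div_nonneg Real.pi_pos.le (mul_nonneg hβ.le hsg0.le)))
    have hsq : Real.sqrt S2 ^ 2 = S2 := Real.sq_sqrt hSpos.le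
    have hπ : Real.pi ≠ 0 := Real.pi_ne_zero
    have hS0 : S2 ≠ 0 := hSpos.ne'
    have hsg1 : sg ≠ 0 := hsg0.ne'
    have hβ0 : β ≠ 0 := hβ.ne'
    have hn2 : n₀ + 1 ≠ 0 := hn1.ne'
    have ht2 : ((1 - ρ) * r / (2 * Real.sqrt S2)) ^ 2 = (1 - ρ) ^ 2 * r ^ 2 / (4 * S2) := by
      rw [div_pow, mul_pow, mul_pow, hsq]; norm_num
    have hinv : β * sg / ((n₀ + 1) * Real.pi) ≤ 1 / S2 := by
      rw [div_le_div_iff₀ (by positivity) hSpos, one_mul]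
      calc β * sg * S2 ≤ β * sg * ((n₀ + 1) * (Real.pi / (β * sg))) := mul_le_mul_of_nonneg_left hSle' (by positivity)
        _ = (n₀ + 1) * Real.pi := by field_simp
    have hexp : (1 - ρ) ^ 2 * sg / (4 * (n₀ + 1)) * (r ^ 2 * β) ≤ Real.pi * ((1 - ρ) * r / (2 * Real.sqrt S2)) ^ 2 := by
      rw [ht2]
      calc (1 - ρ) ^ 2 * sg / (4 * (n₀ + 1)) * (r ^ 2 * β) = (Real.pi * (1 - ρ) ^ 2 * r ^ 2 / 4) * (β * sg / ((n₀ + 1) * Real.pi)) := by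
            field_simp
        _ ≤ (Real.pi * (1 - ρ) ^ 2 * r ^ 2 / 4) * (1 / S2) := mul_le_mul_of_nonneg_left hinv (by positivity)
        _ = Real.pi * ((1 - ρ) ^ 2 * r ^ 2 / (4 * S2)) := by field_simp
    exact mul_le_mul (mul_le_mul_of_nonneg_left hcard zero_le_two) (Real.exp_le_exp.2 (neg_le_neg hexp)) (Real.exp_pos _).le (mul_nonneg zero_le_two hn0)

omit [NeZero L] in
/-- `β⁻¹ ≤ r(β)` eventually. [folklore] -/
theorem eventually_powScale_one_le_rad : ∀ᶠ β : ℝ in atTop, powScale 1 β ≤ min (1 / 40) (powScale (1 / 2) β * btLog β) := by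
  obtain ⟨β0, h⟩ := powScale_eventually_le (p := 1) one_pos (c := 1 / 40) (by norm_num)
  filter_upwards [eventually_ge_atTop β0] with β hβ
  refine le_min (h β hβ) ?_
  have h1 : powScale 1 β ≤ powScale (1 / 2) β := by
    unfold powScale; exact Real.rpow_le_rpow_of_exponent_le (le_max_right _ _) (by norm_num)
  exact h1.trans (le_mul_of_one_le_right (powScale_pos _ _).le (one_le_btLog β))

/-- ★ The gauge exit mass (tail fraction of the gauge Gaussian beyond `u = (1−ρ)r/2` in the window of radius `r`, width `s = β⁻¹`) tends to `0` (`ρ < 1`). [folklore] -/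
theorem tendsto_gaugeTail {ρ : ℝ} (hρ1 : ρ < 1) :
    Tendsto (fun β : ℝ =>
      (∫ z in (Metric.closedBall (0 : gaugeModes L) ((1 - ρ) * min (1 / 40) (powScale (1 / 2) β * btLog β) / 2))ᶜ ∩
          Metric.closedBall (0 : gaugeModes L) (min (1 / 40) (powScale (1 / 2) β * btLog β)), Real.exp (-(‖z‖ ^ 2 / powScale 1 β ^ 2))) /
        (∫ z in Metric.closedBall (0 : gaugeModes L) (min (1 / 40) (powScale (1 / 2) β * btLog β)), Real.exp (-(‖z‖ ^ 2 / powScale 1 β ^ 2)))) atTop (𝓝 0) := by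
  have hCE0 : 0 ≤ Real.exp 1 * (2 * Real.pi) ^ (Module.finrank ℝ (gaugeModes L) / 2 : ℝ) / (volume (Metric.ball (0 : gaugeModes L) 1)).toReal := by positivity
  have h1ρ : 0 < 1 - ρ := sub_pos.2 hρ1
  have hc : 0 < (1 - ρ) ^ 2 / 8 := by positivity
  refine squeeze_zero' (Eventually.of_forall fun β => div_nonneg (integral_nonneg fun z => (Real.exp_pos _).le) (integral_nonneg fun z => (Real.exp_pos _).le)) ?_
    (tendsto_const_mul_exp_neg_rad (Real.exp 1 * (2 * Real.pi) ^ (Module.finrank ℝ (gaugeModes L) / 2 : ℝ) / (volume (Metric.ball (0 : gaugeModes L) 1)).toReal) hc)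
  filter_upwards [eventually_ge_atTop (1 : ℝ), eventually_powScale_one_le_rad] with β hβ1 hsr
  set r : ℝ := min (1 / 40) (powScale (1 / 2) β * btLog β) with hr
  have hr0 : 0 ≤ r := le_min (by norm_num) (mul_nonneg (powScale_pos _ _).le (zero_le_one.trans (one_le_btLog β)))
  have hu : 0 ≤ (1 - ρ) * r / 2 := by positivity
  have htail := Mehler.gaugeTail_le (E := gaugeModes L) (powScale_pos 1 β) hsr hu
  refine htail.trans (mul_le_mul_of_nonneg_left (Real.exp_le_exp.2 (neg_le_neg ?_)) hCE0)
  have hs : powScale 1 β = β⁻¹ := by rw [powScale_eq hβ1, Real.rpow_neg_one]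
  rw [hs]
  have hβ0 : 0 < β := by linarith
  have e : ((1 - ρ) * r / 2) ^ 2 / (2 * β⁻¹ ^ 2) = (1 - ρ) ^ 2 * r ^ 2 * β ^ 2 / 8 := by field_simp; ring
  rw [e]
  have h1 : 0 ≤ (1 - ρ) ^ 2 * r ^ 2 * (β * (β - 1)) := mul_nonneg (by positivity) (mul_nonneg hβ0.le (by linarith))
  nlinarith [h1]

/-- ★ **Core data on the schedule** (`β > 0`, `0 ≤ ρ < 1`, `L ≥ 2`): `R = r√(49β/π) > 0`, `r ≤ γ_kR`, `t = (1−ρ)r/(2√Σγ²) ≥ 0`, and the fit `(ρr + t√Σγ²)² + u² ≤ r²` with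
`u = (1−ρ)r/2`. [folklore] -/
theorem core_fit (hL : 2 ≤ L) {β : ℝ} (hβ : 0 < β) {ρ : ℝ} (hρ0 : 0 ≤ ρ) (hρ1 : ρ < 1) :
    0 < min (1 / 40) (powScale (1 / 2) β * btLog β) * Real.sqrt (49 * β / Real.pi) ∧
    (∀ k : StiffIdx L β, min (1 / 40) (powScale (1 / 2) β * btLog β) ≤ flatScale L β k * (min (1 / 40) (powScale (1 / 2) β * btLog β) * Real.sqrt (49 * β / Real.pi))) ∧
    0 ≤ (1 - ρ) * min (1 / 40) (powScale (1 / 2) β * btLog β) / (2 * Real.sqrt (∑ k : StiffIdx L β, flatScale L β k ^ 2)) ∧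
    (ρ * min (1 / 40) (powScale (1 / 2) β * btLog β) +
          (1 - ρ) * min (1 / 40) (powScale (1 / 2) β * btLog β) / (2 * Real.sqrt (∑ k : StiffIdx L β, flatScale L β k ^ 2)) *
            Real.sqrt (∑ k : StiffIdx L β, flatScale L β k ^ 2)) ^ 2 +
        ((1 - ρ) * min (1 / 40) (powScale (1 / 2) β * btLog β) / 2) ^ 2 ≤ (min (1 / 40) (powScale (1 / 2) β * btLog β)) ^ 2 := by
  set r : ℝ := min (1 / 40) (powScale (1 / 2) β * btLog β) with hr
  set q : ℝ := Real.sqrt (∑ k : StiffIdx L β, flatScale L β k ^ 2) with hq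
  have hr0 : 0 < r := lt_min (by norm_num) (mul_pos (powScale_pos _ _) (lt_of_lt_of_le one_pos (one_le_btLog β)))
  have hq0 : 0 ≤ q := Real.sqrt_nonneg _
  have h1ρ : 0 < 1 - ρ := by linarith
  refine ⟨by positivity, fun k => le_flatScale_mul hL hβ hr0.le k, by positivity, ?_⟩
  -- `t·√Σ ≤ (1−ρ)r/2`
  have hts : (1 - ρ) * r / (2 * q) * q ≤ (1 - ρ) * r / 2 ∧ 0 ≤ (1 - ρ) * r / (2 * q) * q := by
    rcases eq_or_lt_of_le hq0 with h | h
    · rw [← h, mul_zero]; exact ⟨by positivity, le_rfl⟩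
    · exact ⟨by rw [div_mul_eq_mul_div, div_le_div_iff₀ (by positivity) (by norm_num)]; exact le_of_eq (by ring), by positivity⟩
  have hA : ρ * r + (1 - ρ) * r / (2 * q) * q ≤ ρ * r + (1 - ρ) * r / 2 := by linarith [hts.1]
  have hA0 : 0 ≤ ρ * r + (1 - ρ) * r / (2 * q) * q := add_nonneg (mul_nonneg hρ0 hr0.le) hts.2
  have hA2 := pow_le_pow_left₀ hA0 hA 2
  calc (ρ * r + (1 - ρ) * r / (2 * q) * q) ^ 2 + ((1 - ρ) * r / 2) ^ 2 ≤ (ρ * r + (1 - ρ) * r / 2) ^ 2 + ((1 - ρ) * r / 2) ^ 2 := by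
        linarith
    _ = r ^ 2 * ((1 + ρ ^ 2) / 2) := by ring
    _ ≤ r ^ 2 * 1 := by gcongr; nlinarith
    _ = r ^ 2 := mul_one _

/-! ## §2 The flat Poincaré hypothesis of `spec_gap_inputs_of_hflat` -/

/-- `∫_{cS} cD dπ ≤ (1+ε)·cZ` from the pointwise density comparison on `cS`. [folklore] -/
theorem setIntegral_cD_le_cZ {s M β ε : ℝ} (hε : 0 ≤ ε) (hcmp : ∀ x ∈ cS L β, cD L β x ≤ (1 + ε) * (cΘ L β x ^ 2 * cW L s M β x)) :
    ∫ x in cS L β, cD L β x ∂orthoTransverse L ≤ (1 + ε) * cZ L s M β := by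
  haveI := isFiniteMeasure_orthoTransverse L
  obtain ⟨hDm, hDpos, hDb⟩ := cD_data (L := L) β
  obtain ⟨hWm, hWb, hW0⟩ := cW_props (L := L) s M β
  obtain ⟨hΘm, hΘb, hΘ0⟩ := cΘ_data (L := L) β
  have hZ : cZ L s M β = ∫ x in cS L β, cΘ L β x ^ 2 * cW L s M β x ∂orthoTransverse L := by
    unfold cZ
    exact (setIntegral_eq_integral_of_forall_compl_eq_zero fun x hx => by rw [cΘ_eq_zero_of_not_mem_cS β x hx]; ring).symm
  rw [hZ, ← integral_const_mul]
  have hb2 : ∀ x, |(1 + ε) * (cΘ L β x ^ 2 * cW L s M β x)| ≤ (1 + ε) * (1 * Real.exp ((Fintype.card (Edge 3 L) : ℝ) / powScale 1 β ^ 2)) := fun x => by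
    rw [abs_mul, abs_of_nonneg (by linarith : (0 : ℝ) ≤ 1 + ε), abs_mul]
    refine mul_le_mul_of_nonneg_left (mul_le_mul ?_ (hWb x) (abs_nonneg _) zero_le_one) (by linarith)
    rw [abs_pow]; have := hΘb x; nlinarith [abs_nonneg (cΘ L β x)]
  refine setIntegral_mono_on (integrable_of_measurable_abs_le _ hDm hDb).integrableOn
    (integrable_of_measurable_abs_le _ (measurable_const.mul ((hΘm.pow_const 2).mul hWm)) hb2).integrableOn (measurableSet_cS β) fun x hx => hcmp x hx

set_option maxHeartbeats 400000 in
/-- ★★★ **`hflat` FOR THE RECORD's CENTRAL FIBRE DOOR.**  For `L ≥ 2` with a non-zero site and `0 < s ≤ 1/3` there is `M₁` such that for every `M ≥ M₁`, with the β-FREE constant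
`P₀ = 8/(1 − ρ_L)`, `ρ_L = 1/(1+√(2 − 2cos(2π/L)))`, and every rate `δ > 0`, for all large `β` and every bounded measurable `g` vanishing off `cS β`:
`∫_{cS} g²cD dπ − (∫_{cS} g cD dπ)²/∫_{cS} cD dπ ≤ P₀·½∫∫ (g x − g y)²·cJ0 s M β x y dπ dπ + δ·∫_{cS} g²cD dπ` — verbatim the hypothesis `hflat` of ✓`spec_gap_inputs_of_hflat`.
[cite: Luscher1983, §3; Wipf2021, §8.5.1 (8.56)–(8.58)] -/
theorem hflat_record (hLz : Nonempty (NzSite L)) (hL2 : 2 ≤ L) {s : ℝ} (hs0 : 0 < s) (hs3 : s ≤ 1 / 3) :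
    ∃ M₁ : ℝ, ∀ M : ℝ, M₁ ≤ M → ∃ P₀ : ℝ, 0 < P₀ ∧ ∀ δ : ℝ, 0 < δ → ∀ᶠ β : ℝ in atTop,
      ∀ g : (Edge 3 L → Fin 3 → ℝ) → ℝ, Measurable g → (∃ C : ℝ, ∀ x, |g x| ≤ C) → (∀ x, x ∉ cS L β → g x = 0) →
        (∫ x in cS L β, g x ^ 2 * cD L β x ∂orthoTransverse L) - (∫ x in cS L β, g x * cD L β x ∂orthoTransverse L) ^ 2 / (∫ x in cS L β, cD L β x ∂orthoTransverse L) ≤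
          P₀ * ((1 / 2) * ∫ x, ∫ y, (g x - g y) ^ 2 * cJ0 L s M β x y ∂orthoTransverse L ∂orthoTransverse L) + δ * ∫ x in cS L β, g x ^ 2 * cD L β x ∂orthoTransverse L := by
  obtain ⟨M₀, -, hcmp⟩ := central_density_compare (L := L) hLz hs0 hs3
  refine ⟨M₀, fun M hM => ?_⟩
  -- the β-free contraction bound and Poincaré constant
  set ρ : ℝ := 1 / (1 + Real.sqrt (2 - 2 * Real.cos (2 * Real.pi / L))) with hρdef
  obtain ⟨hρ0, hρ1⟩ : 0 ≤ ρ ∧ ρ < 1 := flatRho_lt_one (L := L) hL2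
  have hP : 0 < 2 / (1 - ρ) := div_pos two_pos (by linarith)
  refine ⟨4 * (2 / (1 - ρ)), by linarith, fun δ hδ => ?_⟩
  -- eventualities
  obtain ⟨ρ₀, hρ₀, hsharp⟩ := orthoTransverse_restrict_cS_sharp L
  have hsum : Tendsto (fun β : ℝ => (2 * (Fintype.card (StiffIdx L β) : ℝ) *
      Real.exp (-(Real.pi * ((1 - ρ) * min (1 / 40) (powScale (1 / 2) β * btLog β) / (2 * Real.sqrt (∑ k : StiffIdx L β, flatScale L β k ^ 2))) ^ 2)) +
      (∫ z in (Metric.closedBall (0 : gaugeModes L) ((1 - ρ) * min (1 / 40) (powScale (1 / 2) β * btLog β) / 2))ᶜ ∩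
          Metric.closedBall (0 : gaugeModes L) (min (1 / 40) (powScale (1 / 2) β * btLog β)), Real.exp (-(‖z‖ ^ 2 / powScale 1 β ^ 2))) /
        (∫ z in Metric.closedBall (0 : gaugeModes L) (min (1 / 40) (powScale (1 / 2) β * btLog β)), Real.exp (-(‖z‖ ^ 2 / powScale 1 β ^ 2)))) +
      2 * (Fintype.card (StiffIdx L β) : ℝ) *
        Real.exp (-(Real.pi * ((1 - ρ) * (min (1 / 40) (powScale (1 / 2) β * btLog β) * Real.sqrt (49 * β / Real.pi))) ^ 2))) atTop (𝓝 0) := by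
    simpa using ((tendsto_epsCore (L := L) hL2 hρ1).add (tendsto_gaugeTail (L := L) hρ1)).add (tendsto_epsR (L := L) hρ1)
  have hθ : 0 < min (1 / 4) (δ / (2 * (2 / (1 - ρ)))) := lt_min (by norm_num) (div_pos hδ (mul_pos two_pos hP))
  filter_upwards [eventually_action_hessian_cS (L := L) (ε := 1 / 16) (by norm_num), hcmp M hM (1 / 8) (by norm_num), hsharp (1 / 8) (by norm_num),
    eventually_ge_atTop (1 : ℝ), hsum.eventually (eventually_le_nhds hθ)]
    with β hη hcmpβ hsh hβ1 hsmall g hg hgC hgS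
  obtain ⟨hlo, hup⟩ := hsh
  obtain ⟨Cg, hgb⟩ := hgC
  have hβ : 0 < β := by linarith
  haveI := isFiniteMeasure_orthoTransverse L
  -- the flat measure `ν` and its comparison with `π` on `cS β`
  haveI := isAddHaarMeasure_volume_flat (L := L) β
  obtain ⟨κ, hκ, hbal⟩ := balLebesgue_eq_smul_map L (volume : Measure ((StiffIdx L β → ℝ) × gaugeModes L)) (T := flatMap L β) (flatMap_injective hβ) (range_flatMap hβ)
  set ν : Measure (Edge 3 L → Fin 3 → ℝ) := Measure.map (flatMap L β) volume with hν
  have hk : ∀ a : ℝ, 0 ≤ a → ENNReal.ofReal a • (balLebesgue L).restrict (cS L β) = ENNReal.ofReal (a * κ) • ν.restrict (cS L β) := fun a ha => by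
    rw [hbal, Measure.restrict_smul, smul_smul, ENNReal.ofReal_mul ha, ENNReal.ofReal_coe_nnreal]
  set c : ℝ := (1 - 1 / 8) * ρ₀ * κ with hc
  set C : ℝ := (1 + 1 / 8) * ρ₀ * κ with hC
  have hκ' : (0 : ℝ) < κ := by exact_mod_cast hκ
  have hc0 : 0 < c := by positivity
  have hC0 : 0 ≤ C := by positivity
  have hlo' : ENNReal.ofReal c • ν.restrict (cS L β) ≤ (orthoTransverse L).restrict (cS L β) := by rw [hc, ← hk ((1 - 1 / 8) * ρ₀) (by positivity)]; exact hlo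
  have hup' : (orthoTransverse L).restrict (cS L β) ≤ ENNReal.ofReal C • ν.restrict (cS L β) := by rw [hC, ← hk ((1 + 1 / 8) * ρ₀) (by positivity)]; exact hup
  -- `I_ν > 0` from `cIk > 0`
  obtain ⟨hGm, hG0, hGb, hGS⟩ := trueKernel_data (L := L) hβ.le
  have hIcmp : cIk L β ≤ C ^ 2 * ∫ x in cS L β, ∫ y in cS L β, cΘ L β x * cK L β x y * cΘ L β y ∂ν ∂ν := by
    unfold cIk; exact StiffDoor.jumpForm_ge_of_comparison hc0 hC0 hlo' hup' hGm hG0 (fun x y => (le_abs_self _).trans (hGb x y)) hGS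
  have hIk := cIk_pos (L := L) hβ.le
  have hIν : 0 < ∫ x in cS L β, ∫ y in cS L β, cΘ L β x * cK L β x y * cΘ L β y ∂ν ∂ν := by
    have hC2 : 0 < C ^ 2 := by positivity
    by_contra hneg
    have : C ^ 2 * ∫ x in cS L β, ∫ y in cS L β, cΘ L β x * cK L β x y * cΘ L β y ∂ν ∂ν ≤ 0 := mul_nonpos_of_nonneg_of_nonpos hC2.le (not_lt.mp hneg)
    linarith
  -- the pushforward of the flat model
  obtain ⟨hRpos, hRr, ht, hfit⟩ := core_fit (L := L) hL2 hβ hρ0 hρ1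
  have hρk : ∀ k : StiffIdx L β, flatB L β k / (flatA L β k + flatB L β k + Real.pi) ≤ ρ := fun k => flatRatio_le hL2 hβ k
  -- the three exit masses at `β`
  set eC : ℝ := 2 * (Fintype.card (StiffIdx L β) : ℝ) *
      Real.exp (-(Real.pi * ((1 - ρ) * min (1 / 40) (powScale (1 / 2) β * btLog β) / (2 * Real.sqrt (∑ k : StiffIdx L β, flatScale L β k ^ 2))) ^ 2)) with heC
  set eG : ℝ := (∫ z in (Metric.closedBall (0 : gaugeModes L) ((1 - ρ) * min (1 / 40) (powScale (1 / 2) β * btLog β) / 2))ᶜ ∩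
          Metric.closedBall (0 : gaugeModes L) (min (1 / 40) (powScale (1 / 2) β * btLog β)), Real.exp (-(‖z‖ ^ 2 / powScale 1 β ^ 2))) /
        (∫ z in Metric.closedBall (0 : gaugeModes L) (min (1 / 40) (powScale (1 / 2) β * btLog β)), Real.exp (-(‖z‖ ^ 2 / powScale 1 β ^ 2))) with heG
  set eR : ℝ := 2 * (Fintype.card (StiffIdx L β) : ℝ) *
        Real.exp (-(Real.pi * ((1 - ρ) * (min (1 / 40) (powScale (1 / 2) β * btLog β) * Real.sqrt (49 * β / Real.pi))) ^ 2)) with heR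
  have heC0 : 0 ≤ eC := by positivity
  have heG0 : 0 ≤ eG := div_nonneg (integral_nonneg fun z => (Real.exp_pos _).le) (integral_nonneg fun z => (Real.exp_pos _).le)
  have heR0 : 0 ≤ eR := by positivity
  have hεR : eR ≤ 1 / 4 := by linarith [hsmall.trans (min_le_left _ _)]
  have hεS : eC + eG ≤ 1 / 4 := by linarith [hsmall.trans (min_le_left _ _)]
  have hpf := hflat_pushforward (L := L) hβ1 hη hρ0 hρk hρ1 hRpos hRr ht hfit hεR hεS hIν hg hgb hgS
  -- the kernel domination `cΘcKcΘ'·Z_ν/I_ν ≤ K·cJ0`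
  obtain ⟨hDm, hDpos, hDb⟩ := cD_data (L := L) β
  have hZ : c * ∫ x in cS L β, cD L β x ∂ν ≤ ∫ x in cS L β, cD L β x ∂orthoTransverse L :=
    StiffDoor.setIntegral_ge_of_comparison hc0 hlo' hDm (fun x => (hDpos x).le) fun x => (le_abs_self _).trans (hDb x)
  have hZπ0 : 0 ≤ ∫ x in cS L β, cD L β x ∂orthoTransverse L := integral_nonneg fun x => (hDpos x).le
  have hratio := StiffDoor.ratio_le_of_two_sided (C := C) hc0 hZ hIcmp hIν hIk hZπ0
  have hZπ : ∫ x in cS L β, cD L β x ∂orthoTransverse L ≤ (1 + 1 / 8) * cZ L s M β := setIntegral_cD_le_cZ (L := L) (by norm_num) fun x hx => (hcmpβ x hx).2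
  set K : ℝ := C ^ 2 / c * (1 + 1 / 8) with hK
  have hJK : ∀ x y, cΘ L β x * cK L β x y * cΘ L β y *
      ((∫ z in cS L β, cD L β z ∂ν) / ∫ z in cS L β, ∫ w in cS L β, cΘ L β z * cK L β z w * cΘ L β w ∂ν ∂ν) ≤ K * cJ0 L s M β x y := by
    intro x y
    have h1 : (∫ z in cS L β, cD L β z ∂ν) / (∫ z in cS L β, ∫ w in cS L β, cΘ L β z * cK L β z w * cΘ L β w ∂ν ∂ν) ≤ C ^ 2 / c * ((1 + 1 / 8) * (cZ L s M β / cIk L β)) := by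
      refine hratio.trans (mul_le_mul_of_nonneg_left ?_ (by positivity))
      rw [mul_div_assoc']; exact div_le_div_of_nonneg_right hZπ hIk.le
    unfold cJ0
    calc cΘ L β x * cK L β x y * cΘ L β y * ((∫ z in cS L β, cD L β z ∂ν) / ∫ z in cS L β, ∫ w in cS L β, cΘ L β z * cK L β z w * cΘ L β w ∂ν ∂ν)
        ≤ cΘ L β x * cK L β x y * cΘ L β y * (C ^ 2 / c * ((1 + 1 / 8) * (cZ L s M β / cIk L β))) := mul_le_mul_of_nonneg_left h1 (hG0 x y)
      _ = K * (cΘ L β x * cK L β x y * cΘ L β y * (cZ L s M β / cIk L β)) := by rw [hK]; ring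
  -- transport to `π`
  have hJ₁m : Measurable (Function.uncurry fun x y => cΘ L β x * cK L β x y * cΘ L β y *
      ((∫ z in cS L β, cD L β z ∂ν) / ∫ z in cS L β, ∫ w in cS L β, cΘ L β z * cK L β z w * cΘ L β w ∂ν ∂ν)) := hGm.mul measurable_const
  have hZν0 : 0 ≤ ∫ z in cS L β, cD L β z ∂ν := integral_nonneg fun x => (hDpos x).le
  have hJ₁0 : ∀ x y, 0 ≤ cΘ L β x * cK L β x y * cΘ L β y *
      ((∫ z in cS L β, cD L β z ∂ν) / ∫ z in cS L β, ∫ w in cS L β, cΘ L β z * cK L β z w * cΘ L β w ∂ν ∂ν) := fun x y => mul_nonneg (hG0 x y) (div_nonneg hZν0 hIν.le)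
  have hJ₁b : ∀ x y, |cΘ L β x * cK L β x y * cΘ L β y *
      ((∫ z in cS L β, cD L β z ∂ν) / ∫ z in cS L β, ∫ w in cS L β, cΘ L β z * cK L β z w * cΘ L β w ∂ν ∂ν)| ≤
        1 * |(∫ z in cS L β, cD L β z ∂ν) / ∫ z in cS L β, ∫ w in cS L β, cΘ L β z * cK L β z w * cΘ L β w ∂ν ∂ν| := fun x y => by
    rw [abs_mul]; exact mul_le_mul_of_nonneg_right (hGb x y) (abs_nonneg _)
  have hJ₁S : ∀ x y, cΘ L β x * cK L β x y * cΘ L β y *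
      ((∫ z in cS L β, cD L β z ∂ν) / ∫ z in cS L β, ∫ w in cS L β, cΘ L β z * cK L β z w * cΘ L β w ∂ν ∂ν) ≠ 0 → x ∈ cS L β ∧ y ∈ cS L β :=
    fun x y h => hGS x y (left_ne_zero_of_mul h)
  have hvc := vacCoef_pos (σ := StiffIdx L β)
  have hP₀' : 0 ≤ vacCoef (StiffIdx L β) ^ 2 * Real.exp (2 * (1 / 16)) * (Real.exp (2 * (1 / 16)) / vacCoef (StiffIdx L β) ^ 2) * (2 / (1 - ρ)) := mul_nonneg (by positivity) hP.le
  have hδ' : 0 ≤ 2 / (1 - ρ) * (eC + eG + eR) := mul_nonneg hP.le (by linarith)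
  have htr := StiffDoor.poincare_transport_of_kernel_le (μ := orthoTransverse L) (ν := ν) (S := cS L β) hc0 hC0 hlo' hup' hg hgb hDm hDb (fun x => (hDpos x).le)
    hJ₁m hJ₁b hJ₁0 hJ₁S (measurable_cJ0 (L := L) s M β) (abs_cJ0_le (L := L) hβ.le s M) hJK hP₀' hδ' hpf
  -- the constants
  have hJF0 : 0 ≤ ∫ x, ∫ y, (g x - g y) ^ 2 * cJ0 L s M β x y ∂orthoTransverse L ∂orthoTransverse L :=
    integral_nonneg fun x => integral_nonneg fun y => mul_nonneg (sq_nonneg _) (by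
      unfold cJ0; exact mul_nonneg (hG0 x y) (div_nonneg (cZ_nonneg (L := L) s M β) hIk.le))
  have hN0 : 0 ≤ ∫ x in cS L β, g x ^ 2 * cD L β x ∂orthoTransverse L := integral_nonneg fun x => mul_nonneg (sq_nonneg _) (hDpos x).le
  have hCc : C / c = 9 / 7 := by rw [hC, hc]; field_simp; norm_num
  have he4 : Real.exp (2 * (1 / 16)) * Real.exp (2 * (1 / 16)) ≤ 4 / 3 := by
    rw [← Real.exp_add]; refine (Real.exp_bound_div_one_sub_of_interval (by norm_num) (by norm_num)).trans ?_; norm_num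
  have hcoefP : C / c ^ 2 * K * (vacCoef (StiffIdx L β) ^ 2 * Real.exp (2 * (1 / 16)) * (Real.exp (2 * (1 / 16)) / vacCoef (StiffIdx L β) ^ 2) * (2 / (1 - ρ))) ≤
      4 * (2 / (1 - ρ)) := by
    have hρ1' : (1 : ℝ) - ρ ≠ 0 := by linarith
    have e1 : C / c ^ 2 * K * (vacCoef (StiffIdx L β) ^ 2 * Real.exp (2 * (1 / 16)) * (Real.exp (2 * (1 / 16)) / vacCoef (StiffIdx L β) ^ 2) * (2 / (1 - ρ))) =
        (C / c) ^ 3 * (1 + 1 / 8) * (Real.exp (2 * (1 / 16)) * Real.exp (2 * (1 / 16))) * (2 / (1 - ρ)) := by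
      rw [hK]; field_simp
    rw [e1, hCc]
    have h2 : (9 / 7 : ℝ) ^ 3 * (1 + 1 / 8) * (Real.exp (2 * (1 / 16)) * Real.exp (2 * (1 / 16))) ≤ (9 / 7 : ℝ) ^ 3 * (1 + 1 / 8) * (4 / 3) := by gcongr
    have h3 : (9 / 7 : ℝ) ^ 3 * (1 + 1 / 8) * (4 / 3) ≤ 4 := by norm_num
    exact mul_le_mul_of_nonneg_right (h2.trans h3) hP.le
  have hcoefδ : C / c * (2 / (1 - ρ) * (eC + eG + eR)) ≤ δ := by
    rw [hCc]
    have h1 : eC + eG + eR ≤ δ / (2 * (2 / (1 - ρ))) := hsmall.trans (min_le_right _ _)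
    rw [le_div_iff₀ (mul_pos two_pos hP)] at h1
    have hE0 : 0 ≤ eC + eG + eR := by linarith
    calc 9 / 7 * (2 / (1 - ρ) * (eC + eG + eR)) ≤ 2 * (2 / (1 - ρ) * (eC + eG + eR)) := mul_le_mul_of_nonneg_right (by norm_num) (mul_nonneg hP.le hE0)
      _ = (eC + eG + eR) * (2 * (2 / (1 - ρ))) := by ring
      _ ≤ δ := h1
  have hJF0' : (0 : ℝ) ≤ (1 / 2) * ∫ x, ∫ y, (g x - g y) ^ 2 * cJ0 L s M β x y ∂orthoTransverse L ∂orthoTransverse L := mul_nonneg (by norm_num) hJF0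
  exact htr.trans (add_le_add (mul_le_mul_of_nonneg_right hcoefP hJF0') (mul_le_mul_of_nonneg_right hcoefδ hN0))

/-! ## §3 The pen closed -/

/-- ★★★ **THE (B-ST) PEN**: for `L ≥ 2` with a non-zero site and `1/6 < s < 1/4` there is `M₀ ≥ 2` with `RecordAnalyticInput L s M` inhabited for every `M ≥ M₀` — composition of
✓`recordAnalyticInput_of_specs` with ✓`spec_S3` (hand w1) and ✓`spec_gap_inputs_of_hflat` ∘ `hflat_record`. [cite: Luscher1983, §3] [cite: SjostrandZworski2007, §2] -/
theorem recordAnalyticInput (hLz : Nonempty (NzSite L)) (hL2 : 2 ≤ L) {s : ℝ} (hs6 : 1 / 6 < s) (hs4 : s < 1 / 4) :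
    ∃ M₀ : ℝ, 2 ≤ M₀ ∧ ∀ M : ℝ, M₀ ≤ M → Nonempty (RecordAnalyticInput L s M) :=
  recordAnalyticInput_of_specs (L := L) hLz hL2 hs6 hs4 (spec_S3 (L := L) hLz hL2 hs6 hs4)
    (spec_gap_inputs_of_hflat (L := L) hLz hL2 hs6 hs4 (hflat_record (L := L) hLz hL2 (by linarith) (by linarith)))

end Summit.QuantumFields.YangMills.Theorems.FemtoTransferGap.TwoLattice.ConstTube

end
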